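/-
Free seat `ym-line-cbag-p1` LEAD (prover-ym-line-cbag-p1-g5-0; own items 22254 `BoxFloorAllGroups` / 22893 `ExpChartPackage2` closed), route
`ColdBoxAllGroups`, helping crux `BulkAllGroups` (stmt-QuantumFields-22255), line `dlr-chessboard-G`, lead p2's PLAN v6 work package «p1:
KernelDatumBoundsG» — part 1: generic eventual reductions and the monomial dictionary of the datum parameters (symbolic constants).
-/
import Summits.QuantumFields.YangMills.Theorems.ColdBoxAllGroupsBoxFloorAllGroupsExponentsGPrelims
import Summits.QuantumFields.YangMills.Theorems.WeakCouplingRatesEventuallyPow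

/-!
# Crux `BulkAllGroups` (stmt-QuantumFields-22255), stubs N2-cov-G / N2-mean-G, package «KernelDatumBoundsG», part 1: reductions and
# monomial bounds for the datum parameters (`θ`-family of PLAN v6: `δ = θ/5`, `A = θ/20`, `ε = 6θ`; constants `Ca, CE, C₂, D` symbolic)

With `y = β^θ`, `H = ⌈y⌉` (`2H+3 ≤ 7y`, `2H+1 ≤ 5y`, `12H²+2H+1 ≤ 53y²`, `…ExponentsGPrelims.box_counts`), the PLAN-v6 parameters are bounded by
pure monomials `C·β^s` (or `C·β^s·e^{−b₀β^a}`) at every `β ≥ 1`: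
* datum radius `r = Ca·β^{3θ+θ/5−1/2}` (`√β·r = Ca·β^{3θ+θ/5}`, `r ≤ Ca·β^{6θ−1/2}`); link radius
  `m = 2(12H²+2H+1)(√2·√(β^{2(6θ)−1}) + 8r) ≤ cm·β^{8θ−1/2}`, `cm = 106(√2 + 8Ca)` (`linkRadiusD_le`), `r ≤ m` (`datumRadius_le_linkRadiusD`);
* scaled background `R' = √(β·CE(2H+3)⁴β^{2(θ/5)−1}) + 4√β·r ≤ cR·β^{3θ+θ/5}`, `cR = 49√CE + 4Ca` (`backgroundD_le`); the moment constants
  `K₁ = 2D(R'²+2)`, `K₂ = 3D²(R'⁴+11)`, `K₁²`, `2(1+2D²(R'⁴+3))` as monomials (`momentsD_le`);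
* cubic remainder and tilt: `τ = 190βm³ ≤ 190cm³β^{24θ−1/2}`, `w = 120(2H+1)⁴τ + 4(2H+1)⁴(2C₂m²) ≤ A₁β^{28θ−1/2} + A₂β^{20θ−1}` (`tiltD_le`);
* Gaussian radius `R = β^{6θ}/(4(√D+1))`: `R²/2 = b₀β^{12θ}`, `b₀ = 1/(32(√D+1)²)`; bad mass `P = 240D(2H+1)⁴e^{−R²/2} ≤ 150000·D·β^{4θ}e^{−b₀β^{12θ}}`,
  `√P ≤ √(150000D)·β^{2θ}e^{−(b₀/2)β^{12θ}}` (`badMassD_le`, `sqrt_badMassD_le`); the Gaussian chart bound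
  `mE = √D(12H²+2H+1)((R+R') + 4√β r)/√β ≤ (12H²+2H+1)(¼β^{6θ−1/2} + √D(cR+4Ca)β^{3θ+θ/5−1/2})` (`mED_le`);
* two generic reductions with a general target `β^b/n`: `eventually_le_rpow_div_of_le_rpow` (`f ≤ Cβ^s`, `s < b`) and
  `eventually_le_rpow_div_of_le_rpow_mul_exp` (`f ≤ Cβ^s e^{−b₀β^a}`, `a, b₀ > 0`, any `b`).
Part 2 (`…KernelDatumBoundsG`) assembles `eventually_kernelDatum_boundsG`.  Pure real analysis; no sorry; no definition; standard axioms.  NOT a claim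
about the mass gap: rung-level support (R2xi-G `XiPow`, RECORD label); the Yang–Mills mass gap is NOT proved by any of this.
-/

set_option autoImplicit false

noncomputable section

open Filter Topology Finset Real

namespace Summit.QuantumFields.YangMills.Theorems.ColdBoxAllGroups

open Summit.QuantumFields.YangMills.Theorems.WeakCouplingRates

/-! ## Generic eventual reductions with a general target `β^b / n` -/

/-- A quantity bounded by `C·β^s` (`β ≥ 1`) with `s < b` is eventually `≤ β^b/n`, for every `n > 0`. [folklore] -/
theorem eventually_le_rpow_div_of_le_rpow {s b C n : ℝ} {f : ℝ → ℝ} (hsb : s < b) (hn : 0 < n)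
    (hf : ∀ β : ℝ, 1 ≤ β → f β ≤ C * β ^ s) : ∀ᶠ β : ℝ in atTop, f β ≤ β ^ b / n := by
  have ht := tendsto_const_mul_rpow_of_neg (n * C) (s := b - s) (by linarith)
  filter_upwards [eventually_le_one_of_tendsto_zero ht, eventually_ge_atTop (1 : ℝ)] with β hg hβ
  have hβ0 : 0 < β := by linarith
  have hX : 0 ≤ β ^ b / n := by positivity
  have e : C * β ^ s = (n * C * β ^ (-(b - s))) * (β ^ b / n) := by
    have : β ^ s = β ^ (-(b - s)) * β ^ b := by rw [← Real.rpow_add hβ0]; congr 1; ring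
    rw [this]; field_simp
  calc f β ≤ C * β ^ s := hf β hβ
    _ = (n * C * β ^ (-(b - s))) * (β ^ b / n) := e
    _ ≤ 1 * (β ^ b / n) := mul_le_mul_of_nonneg_right hg hX
    _ = β ^ b / n := one_mul _

/-- A quantity bounded by `C·β^s·e^{−b₀β^a}` (`β ≥ 1`, `a, b₀ > 0`) is eventually `≤ β^b/n`, for every `b` and every `n > 0`. [folklore] -/
theorem eventually_le_rpow_div_of_le_rpow_mul_exp {s a b₀ C : ℝ} (b : ℝ) {n : ℝ} {f : ℝ → ℝ} (ha : 0 < a) (hb₀ : 0 < b₀) (hn : 0 < n)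
    (hf : ∀ β : ℝ, 1 ≤ β → f β ≤ C * β ^ s * Real.exp (-(b₀ * β ^ a))) : ∀ᶠ β : ℝ in atTop, f β ≤ β ^ b / n := by
  have ht := tendsto_const_mul_rpow_mul_exp_neg (n * C) (s - b) ha hb₀
  filter_upwards [eventually_le_one_of_tendsto_zero ht, eventually_ge_atTop (1 : ℝ)] with β hg hβ
  have hβ0 : 0 < β := by linarith
  have hX : 0 ≤ β ^ b / n := by positivity
  have e : C * β ^ s * Real.exp (-(b₀ * β ^ a)) = (n * C * β ^ (s - b) * Real.exp (-(b₀ * β ^ a))) * (β ^ b / n) := by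
    have : β ^ s = β ^ (s - b) * β ^ b := by rw [← Real.rpow_add hβ0]; congr 1; ring
    rw [this]; field_simp
  calc f β ≤ C * β ^ s * Real.exp (-(b₀ * β ^ a)) := hf β hβ
    _ = (n * C * β ^ (s - b) * Real.exp (-(b₀ * β ^ a))) * (β ^ b / n) := e
    _ ≤ 1 * (β ^ b / n) := mul_le_mul_of_nonneg_right hg hX
    _ = β ^ b / n := one_mul _

/-! ## The datum radius `r = Ca·β^{3θ+θ/5−1/2}` and the link radius `m` -/

/-- `√β·r = Ca·β^{3θ+θ/5}` and `r ≤ Ca·β^{6θ−1/2}` (`β ≥ 1`, `θ ≥ 0`, `Ca ≥ 0`). [folklore] -/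
theorem datumRadius_facts {β θ Ca : ℝ} (hβ : 1 ≤ β) (hθ : 0 ≤ θ) (hCa : 0 ≤ Ca) :
    Real.sqrt β * (Ca * β ^ (3 * θ + θ / 5 - 1 / 2)) = Ca * β ^ (3 * θ + θ / 5) ∧
      Ca * β ^ (3 * θ + θ / 5 - 1 / 2) ≤ Ca * β ^ (6 * θ - 1 / 2) := by
  have hβ0 : 0 < β := by linarith
  refine ⟨?_, mul_le_mul_of_nonneg_left (Real.rpow_le_rpow_of_exponent_le hβ (by linarith)) hCa⟩
  rw [Real.sqrt_eq_rpow, show Ca * β ^ (3 * θ + θ / 5) = Ca * (β ^ (1 / 2 : ℝ) * β ^ (3 * θ + θ / 5 - 1 / 2)) by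
    rw [← Real.rpow_add hβ0]; ring_nf]
  ring

/-- `√(β^{2(6θ)−1}) = β^{6θ−1/2}` (`β ≥ 0`). [folklore] -/
theorem sqrt_rpow_twelve {β θ : ℝ} (hβ : 0 ≤ β) : Real.sqrt (β ^ (2 * (6 * θ) - 1)) = β ^ (6 * θ - 1 / 2) := by
  rw [Real.sqrt_eq_rpow, ← Real.rpow_mul hβ]; congr 1; ring

/-- **The link radius as a monomial**: `m = 2(12H²+2H+1)(√2·√(β^{2(6θ)−1}) + 8r) ≤ 106(√2 + 8Ca)·β^{8θ−1/2}` (`β ≥ 1`, `θ ≥ 0`, `Ca ≥ 0`).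
[folklore] -/
theorem linkRadiusD_le {β θ Ca : ℝ} (hβ : 1 ≤ β) (hθ : 0 ≤ θ) (hCa : 0 ≤ Ca) :
    2 * ((12 * (⌈β ^ θ⌉₊ : ℝ) ^ 2 + 2 * ⌈β ^ θ⌉₊ + 1) *
        (Real.sqrt 2 * Real.sqrt (β ^ (2 * (6 * θ) - 1)) + 8 * (Ca * β ^ (3 * θ + θ / 5 - 1 / 2)))) ≤
      106 * (Real.sqrt 2 + 8 * Ca) * β ^ (8 * θ - 1 / 2) := by
  have hβ0 : 0 < β := by linarith
  obtain ⟨-, -, -, -, hP⟩ := box_counts hβ hθ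
  obtain ⟨-, hr⟩ := datumRadius_facts hβ hθ hCa
  rw [sqrt_rpow_twelve hβ0.le]
  have hy2 : (β ^ θ) ^ 2 = β ^ (2 * θ) := by rw [rpow_theta_pow hβ0.le 2]; norm_num
  have hsplit : β ^ (2 * θ) * β ^ (6 * θ - 1 / 2) = β ^ (8 * θ - 1 / 2) := by rw [← Real.rpow_add hβ0]; ring_nf
  have hin : Real.sqrt 2 * β ^ (6 * θ - 1 / 2) + 8 * (Ca * β ^ (3 * θ + θ / 5 - 1 / 2)) ≤ (Real.sqrt 2 + 8 * Ca) * β ^ (6 * θ - 1 / 2) := by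
    nlinarith [Real.sqrt_nonneg 2]
  have hin0 : 0 ≤ Real.sqrt 2 * β ^ (6 * θ - 1 / 2) + 8 * (Ca * β ^ (3 * θ + θ / 5 - 1 / 2)) := by positivity
  have hP0 : (0 : ℝ) ≤ 12 * (⌈β ^ θ⌉₊ : ℝ) ^ 2 + 2 * ⌈β ^ θ⌉₊ + 1 := by positivity
  have hpos : 0 ≤ β ^ (6 * θ - 1 / 2) := Real.rpow_nonneg hβ0.le _
  calc 2 * ((12 * (⌈β ^ θ⌉₊ : ℝ) ^ 2 + 2 * ⌈β ^ θ⌉₊ + 1) *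
        (Real.sqrt 2 * β ^ (6 * θ - 1 / 2) + 8 * (Ca * β ^ (3 * θ + θ / 5 - 1 / 2))))
      ≤ 2 * ((53 * (β ^ θ) ^ 2) * ((Real.sqrt 2 + 8 * Ca) * β ^ (6 * θ - 1 / 2))) := by
        gcongr
    _ = 106 * (Real.sqrt 2 + 8 * Ca) * (β ^ (2 * θ) * β ^ (6 * θ - 1 / 2)) := by rw [hy2]; ring
    _ = 106 * (Real.sqrt 2 + 8 * Ca) * β ^ (8 * θ - 1 / 2) := by rw [hsplit]

/-- The link radius is nonnegative. -/
theorem linkRadiusD_nonneg (β θ Ca : ℝ) (hCa : 0 ≤ Ca) (hβ : 0 ≤ β) :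
    0 ≤ 2 * ((12 * (⌈β ^ θ⌉₊ : ℝ) ^ 2 + 2 * ⌈β ^ θ⌉₊ + 1) *
        (Real.sqrt 2 * Real.sqrt (β ^ (2 * (6 * θ) - 1)) + 8 * (Ca * β ^ (3 * θ + θ / 5 - 1 / 2)))) := by
  have : 0 ≤ Ca * β ^ (3 * θ + θ / 5 - 1 / 2) := mul_nonneg hCa (Real.rpow_nonneg hβ _)
  positivity

/-- **The exterior datum sits inside the link window**: `r ≤ m` (indeed `m ≥ 16r`). [folklore] -/
theorem datumRadius_le_linkRadiusD (β θ : ℝ) {Ca : ℝ} (hCa : 0 ≤ Ca) (hβ : 0 ≤ β) :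
    Ca * β ^ (3 * θ + θ / 5 - 1 / 2) ≤
      2 * ((12 * (⌈β ^ θ⌉₊ : ℝ) ^ 2 + 2 * ⌈β ^ θ⌉₊ + 1) *
        (Real.sqrt 2 * Real.sqrt (β ^ (2 * (6 * θ) - 1)) + 8 * (Ca * β ^ (3 * θ + θ / 5 - 1 / 2)))) := by
  have hr : 0 ≤ Ca * β ^ (3 * θ + θ / 5 - 1 / 2) := mul_nonneg hCa (Real.rpow_nonneg hβ _)
  have hP : (1 : ℝ) ≤ 12 * (⌈β ^ θ⌉₊ : ℝ) ^ 2 + 2 * ⌈β ^ θ⌉₊ + 1 := by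
    have : (0 : ℝ) ≤ (⌈β ^ θ⌉₊ : ℝ) := Nat.cast_nonneg _
    nlinarith
  have hs : 0 ≤ Real.sqrt 2 * Real.sqrt (β ^ (2 * (6 * θ) - 1)) := by positivity
  nlinarith

/-! ## The scaled background bound `R'` and the Gaussian moment constants -/

/-- `√(β·(CE·X⁴·β^{2(θ/5)−1})) = √CE·(X²·β^{θ/5})` (`β > 0`). [folklore] -/
theorem sqrt_beta_energyD_eq {β θ CE : ℝ} (hβ : 0 < β) (X : ℝ) :
    Real.sqrt (β * (CE * X ^ 4 * β ^ (2 * (θ / 5) - 1))) = Real.sqrt CE * (X ^ 2 * β ^ (θ / 5)) := by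
  have e1 : β * β ^ (2 * (θ / 5) - 1) = (β ^ (θ / 5)) ^ 2 := by
    rw [show (β ^ (θ / 5)) ^ 2 = β ^ (2 * (θ / 5)) by
      rw [show (2 : ℝ) * (θ / 5) = θ / 5 * ((2 : ℕ) : ℝ) by push_cast; ring, Real.rpow_mul_natCast hβ.le]]
    rw [show β * β ^ (2 * (θ / 5) - 1) = β ^ (1 : ℝ) * β ^ (2 * (θ / 5) - 1) by rw [Real.rpow_one], ← Real.rpow_add hβ]
    ring_nf
  have hY : 0 ≤ X ^ 2 * β ^ (θ / 5) := by positivity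
  have hin : β * (CE * X ^ 4 * β ^ (2 * (θ / 5) - 1)) = CE * (X ^ 2 * β ^ (θ / 5)) ^ 2 := by
    linear_combination (CE * X ^ 4) * e1
  rw [hin, Real.sqrt_mul' _ (by positivity), Real.sqrt_sq hY]

/-- **The scaled background bound as a monomial**: `R' = √(β·CE(2H+3)⁴β^{2(θ/5)−1}) + 4√β·r ≤ (49√CE + 4Ca)·β^{3θ+θ/5}` (`β ≥ 1`, `θ ≥ 0`,
`Ca ≥ 0`). [folklore] -/
theorem backgroundD_le {β θ Ca CE : ℝ} (hβ : 1 ≤ β) (hθ : 0 ≤ θ) (hCa : 0 ≤ Ca) :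
    Real.sqrt (β * (CE * (2 * (⌈β ^ θ⌉₊ : ℝ) + 3) ^ 4 * β ^ (2 * (θ / 5) - 1))) +
        4 * (Real.sqrt β * (Ca * β ^ (3 * θ + θ / 5 - 1 / 2))) ≤
      (49 * Real.sqrt CE + 4 * Ca) * β ^ (3 * θ + θ / 5) := by
  have hβ0 : 0 < β := by linarith
  obtain ⟨hsr, -⟩ := datumRadius_facts hβ hθ hCa
  rw [sqrt_beta_energyD_eq hβ0, hsr]
  have hX : (2 * (⌈β ^ θ⌉₊ : ℝ) + 3) ^ 2 ≤ 49 * β ^ (2 * θ) := by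
    have h := boxSide_pow_le hβ hθ 2
    norm_num at h
    simpa [show ((2 : ℕ) : ℝ) * θ = 2 * θ by push_cast; ring] using h
  have hmono : β ^ (2 * θ) * β ^ (θ / 5) ≤ β ^ (3 * θ + θ / 5) := by
    rw [← Real.rpow_add hβ0]; exact Real.rpow_le_rpow_of_exponent_le hβ (by linarith)
  have h5 : 0 ≤ β ^ (θ / 5) := Real.rpow_nonneg hβ0.le _
  have hCE : 0 ≤ Real.sqrt CE := Real.sqrt_nonneg _
  have h1 : Real.sqrt CE * ((2 * (⌈β ^ θ⌉₊ : ℝ) + 3) ^ 2 * β ^ (θ / 5)) ≤ 49 * Real.sqrt CE * β ^ (3 * θ + θ / 5) := by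
    calc Real.sqrt CE * ((2 * (⌈β ^ θ⌉₊ : ℝ) + 3) ^ 2 * β ^ (θ / 5)) ≤ Real.sqrt CE * ((49 * β ^ (2 * θ)) * β ^ (θ / 5)) := by gcongr
      _ = 49 * Real.sqrt CE * (β ^ (2 * θ) * β ^ (θ / 5)) := by ring
      _ ≤ 49 * Real.sqrt CE * β ^ (3 * θ + θ / 5) := mul_le_mul_of_nonneg_left hmono (by positivity)
  linarith

/-- **The moment constants as monomials**: if `0 ≤ R' ≤ cR·β^c` (`c ≥ 0`, `β ≥ 1`) then `K₁ = 2D(R'²+2) ≤ 2D(cR²+2)β^{2c}`,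
`K₂ = 3D²(R'⁴+11) ≤ 3D²(cR⁴+11)β^{4c}`, `K₁² ≤ 4D²(cR²+2)²β^{4c}`, and `2(1+2D²(R'⁴+3)) ≤ 2(1+2D²(cR⁴+3))β^{4c}`. [folklore] -/
theorem momentsD_le (D : ℕ) {β c R' cR : ℝ} (hβ : 1 ≤ β) (hc : 0 ≤ c) (hR'0 : 0 ≤ R') (hR' : R' ≤ cR * β ^ c) :
    2 * (D : ℝ) * (R' ^ 2 + 2) ≤ 2 * D * (cR ^ 2 + 2) * β ^ (2 * c) ∧
      3 * (D : ℝ) ^ 2 * (R' ^ 4 + 11) ≤ 3 * (D : ℝ) ^ 2 * (cR ^ 4 + 11) * β ^ (4 * c) ∧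
      (2 * (D : ℝ) * (R' ^ 2 + 2)) ^ 2 ≤ 4 * (D : ℝ) ^ 2 * (cR ^ 2 + 2) ^ 2 * β ^ (4 * c) ∧
      2 * (1 + 2 * (D : ℝ) ^ 2 * (R' ^ 4 + 3)) ≤ 2 * (1 + 2 * (D : ℝ) ^ 2 * (cR ^ 4 + 3)) * β ^ (4 * c) := by
  have hβ0 : 0 < β := by linarith
  have hD : (0 : ℝ) ≤ D := Nat.cast_nonneg _
  have hb2 : 1 ≤ β ^ (2 * c) := Real.one_le_rpow hβ (by positivity)
  have hb4 : 1 ≤ β ^ (4 * c) := Real.one_le_rpow hβ (by positivity)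
  have h2 : R' ^ 2 ≤ cR ^ 2 * β ^ (2 * c) := by
    have h := pow_le_pow_left₀ hR'0 hR' 2
    rw [mul_pow, rpow_theta_pow hβ0.le] at h; push_cast at h; exact h
  have h4 : R' ^ 4 ≤ cR ^ 4 * β ^ (4 * c) := by
    have h := pow_le_pow_left₀ hR'0 hR' 4
    rw [mul_pow, rpow_theta_pow hβ0.le] at h; push_cast at h; exact h
  have hK1 : R' ^ 2 + 2 ≤ (cR ^ 2 + 2) * β ^ (2 * c) := by nlinarith
  have hK2 : R' ^ 4 + 11 ≤ (cR ^ 4 + 11) * β ^ (4 * c) := by nlinarith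
  have hK3 : R' ^ 4 + 3 ≤ (cR ^ 4 + 3) * β ^ (4 * c) := by nlinarith
  have hsq : (β ^ (2 * c)) ^ 2 = β ^ (4 * c) := by rw [rpow_theta_pow hβ0.le]; push_cast; ring_nf
  refine ⟨by nlinarith, by nlinarith [sq_nonneg (D : ℝ)], ?_, ?_⟩
  · have h := pow_le_pow_left₀ (by positivity : (0 : ℝ) ≤ 2 * D * (R' ^ 2 + 2)) (show 2 * (D : ℝ) * (R' ^ 2 + 2) ≤
      2 * D * (cR ^ 2 + 2) * β ^ (2 * c) by nlinarith) 2
    calc (2 * (D : ℝ) * (R' ^ 2 + 2)) ^ 2 ≤ (2 * D * (cR ^ 2 + 2) * β ^ (2 * c)) ^ 2 := h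
      _ = 4 * (D : ℝ) ^ 2 * (cR ^ 2 + 2) ^ 2 * (β ^ (2 * c)) ^ 2 := by ring
      _ = _ := by rw [hsq]
  · have hD2 : 0 ≤ 2 * (D : ℝ) ^ 2 := by positivity
    have h1 : (1 : ℝ) ≤ 1 * β ^ (4 * c) := by linarith
    nlinarith [mul_le_mul_of_nonneg_left hK3 hD2]

/-! ## The cubic remainder `τ` and the tilt size `w` -/

/-- With `0 ≤ m ≤ cm·β^{8θ−1/2}` (`β ≥ 1`): `190βm³ ≤ 190cm³β^{24θ−1/2}` and `m² ≤ cm²β^{16θ−1}`. [folklore] -/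
theorem cubicD_le {β θ m cm : ℝ} (hβ : 1 ≤ β) (hm0 : 0 ≤ m) (hm : m ≤ cm * β ^ (8 * θ - 1 / 2)) :
    190 * β * m ^ 3 ≤ 190 * cm ^ 3 * β ^ (24 * θ - 1 / 2) ∧ m ^ 2 ≤ cm ^ 2 * β ^ (16 * θ - 1) := by
  have hβ0 : 0 < β := by linarith
  have h3 : m ^ 3 ≤ (cm * β ^ (8 * θ - 1 / 2)) ^ 3 := pow_le_pow_left₀ hm0 hm 3
  have h2 : m ^ 2 ≤ (cm * β ^ (8 * θ - 1 / 2)) ^ 2 := pow_le_pow_left₀ hm0 hm 2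
  have e3 : β * (cm * β ^ (8 * θ - 1 / 2)) ^ 3 = cm ^ 3 * β ^ (24 * θ - 1 / 2) := by
    rw [mul_pow, rpow_theta_pow hβ0.le, show β * (cm ^ 3 * β ^ ((3 : ℕ) * (8 * θ - 1 / 2))) =
      cm ^ 3 * (β ^ (1 : ℝ) * β ^ ((3 : ℕ) * (8 * θ - 1 / 2))) by rw [Real.rpow_one]; ring, ← Real.rpow_add hβ0]
    push_cast; ring_nf
  have e2 : (cm * β ^ (8 * θ - 1 / 2)) ^ 2 = cm ^ 2 * β ^ (16 * θ - 1) := by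
    rw [mul_pow, rpow_theta_pow hβ0.le]; push_cast; ring_nf
  refine ⟨?_, h2.trans_eq e2⟩
  calc 190 * β * m ^ 3 ≤ 190 * β * (cm * β ^ (8 * θ - 1 / 2)) ^ 3 := by gcongr
    _ = 190 * (β * (cm * β ^ (8 * θ - 1 / 2)) ^ 3) := by ring
    _ = 190 * cm ^ 3 * β ^ (24 * θ - 1 / 2) := by rw [e3]; ring

/-- **The tilt size as monomials**: with `0 ≤ m ≤ cm·β^{8θ−1/2}`, `C₂ ≥ 0`, `β ≥ 1`, `θ ≥ 0`:
`w = 120(2H+1)⁴(190βm³) + 4(2H+1)⁴(2C₂m²) ≤ 120·625·190·cm³·β^{28θ−1/2} + 4·625·2C₂·cm²·β^{20θ−1}`. [folklore] -/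
theorem tiltD_le {β θ m cm C₂ : ℝ} (hβ : 1 ≤ β) (hθ : 0 ≤ θ) (hC₂ : 0 ≤ C₂) (hm0 : 0 ≤ m) (hm : m ≤ cm * β ^ (8 * θ - 1 / 2)) :
    120 * (2 * (⌈β ^ θ⌉₊ : ℝ) + 1) ^ 4 * (190 * β * m ^ 3) + 4 * (2 * (⌈β ^ θ⌉₊ : ℝ) + 1) ^ 4 * (2 * C₂ * m ^ 2) ≤
      120 * 625 * 190 * cm ^ 3 * β ^ (28 * θ - 1 / 2) + 4 * 625 * (2 * C₂) * cm ^ 2 * β ^ (20 * θ - 1) := by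
  have hβ0 : 0 < β := by linarith
  obtain ⟨hτ, hm2⟩ := cubicD_le (θ := θ) hβ hm0 hm
  have h4 := twoH_pow_four_le hβ hθ
  have hcm : 0 ≤ cm := by
    by_contra h
    have : cm * β ^ (8 * θ - 1 / 2) < 0 := mul_neg_of_neg_of_pos (lt_of_not_ge h) (Real.rpow_pos_of_pos hβ0 _)
    linarith
  have e1 : β ^ (4 * θ) * β ^ (24 * θ - 1 / 2) = β ^ (28 * θ - 1 / 2) := by rw [← Real.rpow_add hβ0]; ring_nf
  have e2 : β ^ (4 * θ) * β ^ (16 * θ - 1) = β ^ (20 * θ - 1) := by rw [← Real.rpow_add hβ0]; ring_nf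
  have hτ0 : 0 ≤ 190 * β * m ^ 3 := by positivity
  have hA : 120 * (2 * (⌈β ^ θ⌉₊ : ℝ) + 1) ^ 4 * (190 * β * m ^ 3) ≤ 120 * 625 * 190 * cm ^ 3 * β ^ (28 * θ - 1 / 2) := by
    calc 120 * (2 * (⌈β ^ θ⌉₊ : ℝ) + 1) ^ 4 * (190 * β * m ^ 3) ≤ 120 * (625 * β ^ (4 * θ)) * (190 * cm ^ 3 * β ^ (24 * θ - 1 / 2)) := by
          gcongr
      _ = 120 * 625 * 190 * cm ^ 3 * (β ^ (4 * θ) * β ^ (24 * θ - 1 / 2)) := by ring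
      _ = _ := by rw [e1]
  have hB : 4 * (2 * (⌈β ^ θ⌉₊ : ℝ) + 1) ^ 4 * (2 * C₂ * m ^ 2) ≤ 4 * 625 * (2 * C₂) * cm ^ 2 * β ^ (20 * θ - 1) := by
    calc 4 * (2 * (⌈β ^ θ⌉₊ : ℝ) + 1) ^ 4 * (2 * C₂ * m ^ 2) ≤ 4 * (625 * β ^ (4 * θ)) * (2 * C₂ * (cm ^ 2 * β ^ (16 * θ - 1))) := by
          gcongr
      _ = 4 * 625 * (2 * C₂) * cm ^ 2 * (β ^ (4 * θ) * β ^ (16 * θ - 1)) := by ring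
      _ = _ := by rw [e2]
  exact add_le_add hA hB

/- `e^{2w} − 1 ≤ 4w` for `0 ≤ w ≤ 1/2` is the landed
`Literature.MathematicalPhysics.QuantumFieldTheory.Balaban1983to89.B9Eq376POneLetters.exp_two_mul_sub_one_le_four_mul` (imported by part 2). -/

/-! ## The Gaussian radius `R = β^{6θ}/(4(√D+1))`, the bad mass `P`, and the Gaussian chart bound `mE` -/

/-- `R²/2 = b₀·β^{12θ}`, `b₀ = 1/(32(√D+1)²)`. [folklore] -/
theorem gaussRadiusD_sq_div_two (D : ℕ) {β θ : ℝ} (hβ : 0 ≤ β) :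
    (β ^ (6 * θ) / (4 * (Real.sqrt D + 1))) ^ 2 / 2 = 1 / (32 * (Real.sqrt D + 1) ^ 2) * β ^ (12 * θ) := by
  have hD : 0 < Real.sqrt D + 1 := by positivity
  rw [div_pow, ← Real.rpow_natCast (β ^ (6 * θ)) 2, ← Real.rpow_mul hβ]
  have : 6 * θ * ((2 : ℕ) : ℝ) = 12 * θ := by push_cast; ring
  rw [this]
  field_simp
  ring

/-- `√D·R/√β ≤ β^{6θ−1/2}/4` (`β > 0`). [folklore] -/
theorem sqrtD_mul_gaussRadiusD_div_le (D : ℕ) {β θ : ℝ} (hβ : 0 < β) :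
    Real.sqrt D * (β ^ (6 * θ) / (4 * (Real.sqrt D + 1))) / Real.sqrt β ≤ β ^ (6 * θ - 1 / 2) / 4 := by
  have hsβ : 0 < Real.sqrt β := Real.sqrt_pos.2 hβ
  have hD0 : 0 ≤ Real.sqrt (D : ℝ) := Real.sqrt_nonneg _
  have hD1 : 0 < Real.sqrt (D : ℝ) + 1 := by positivity
  have hq : β ^ (6 * θ) / Real.sqrt β = β ^ (6 * θ - 1 / 2) := by
    rw [Real.sqrt_eq_rpow, ← Real.rpow_sub hβ]
  have hfrac : Real.sqrt (D : ℝ) / (Real.sqrt D + 1) ≤ 1 := by rw [div_le_one hD1]; linarith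
  have hpos : 0 ≤ β ^ (6 * θ - 1 / 2) := Real.rpow_nonneg hβ.le _
  calc Real.sqrt D * (β ^ (6 * θ) / (4 * (Real.sqrt D + 1))) / Real.sqrt β
      = Real.sqrt (D : ℝ) / (Real.sqrt D + 1) * (β ^ (6 * θ) / Real.sqrt β) / 4 := by
        field_simp
    _ ≤ 1 * β ^ (6 * θ - 1 / 2) / 4 := by rw [hq]; gcongr
    _ = β ^ (6 * θ - 1 / 2) / 4 := by ring

/-- **The Gaussian bad mass as a monomial times the Gaussian factor**: `P = 240D(2H+1)⁴e^{−R²/2} ≤ 150000·D·β^{4θ}·e^{−b₀β^{12θ}}`. [folklore] -/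
theorem badMassD_le (D : ℕ) {β θ : ℝ} (hβ : 1 ≤ β) (hθ : 0 ≤ θ) :
    240 * (D : ℝ) * (2 * (⌈β ^ θ⌉₊ : ℝ) + 1) ^ 4 * Real.exp (-((β ^ (6 * θ) / (4 * (Real.sqrt D + 1))) ^ 2 / 2)) ≤
      150000 * (D : ℝ) * β ^ (4 * θ) * Real.exp (-(1 / (32 * (Real.sqrt D + 1) ^ 2) * β ^ (12 * θ))) := by
  have hβ0 : 0 < β := by linarith
  rw [← gaussRadiusD_sq_div_two D hβ0.le]
  have h4 := twoH_pow_four_le hβ hθ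
  have hD : (0 : ℝ) ≤ D := Nat.cast_nonneg _
  calc 240 * (D : ℝ) * (2 * (⌈β ^ θ⌉₊ : ℝ) + 1) ^ 4 * Real.exp (-((β ^ (6 * θ) / (4 * (Real.sqrt D + 1))) ^ 2 / 2))
      ≤ 240 * (D : ℝ) * (625 * β ^ (4 * θ)) * Real.exp (-((β ^ (6 * θ) / (4 * (Real.sqrt D + 1))) ^ 2 / 2)) := by gcongr
    _ = _ := by ring

/-- `√P ≤ √(150000·D)·β^{2θ}·e^{−(b₀/2)β^{12θ}}`. [folklore] -/
theorem sqrt_badMassD_le (D : ℕ) {β θ : ℝ} (hβ : 1 ≤ β) (hθ : 0 ≤ θ) :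
    Real.sqrt (240 * (D : ℝ) * (2 * (⌈β ^ θ⌉₊ : ℝ) + 1) ^ 4 * Real.exp (-((β ^ (6 * θ) / (4 * (Real.sqrt D + 1))) ^ 2 / 2))) ≤
      Real.sqrt (150000 * (D : ℝ)) * β ^ (2 * θ) * Real.exp (-(1 / (64 * (Real.sqrt D + 1) ^ 2) * β ^ (12 * θ))) := by
  have hβ0 : 0 < β := by linarith
  refine (Real.sqrt_le_sqrt (badMassD_le D hβ hθ)).trans (le_of_eq ?_)
  have h1 : β ^ (4 * θ) = (β ^ (2 * θ)) ^ 2 := by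
    rw [← Real.rpow_natCast, ← Real.rpow_mul hβ0.le]; congr 1; push_cast; ring
  have hD1 : (0 : ℝ) < Real.sqrt D + 1 := by positivity
  have h2 : Real.exp (-(1 / (32 * (Real.sqrt D + 1) ^ 2) * β ^ (12 * θ))) =
      (Real.exp (-(1 / (64 * (Real.sqrt D + 1) ^ 2) * β ^ (12 * θ)))) ^ 2 := by
    rw [← Real.exp_nat_mul]; congr 1; push_cast; field_simp; ring
  rw [h1, h2, show 150000 * (D : ℝ) * (β ^ (2 * θ)) ^ 2 * Real.exp (-(1 / (64 * (Real.sqrt D + 1) ^ 2) * β ^ (12 * θ))) ^ 2 =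
    150000 * (D : ℝ) * (β ^ (2 * θ) * Real.exp (-(1 / (64 * (Real.sqrt D + 1) ^ 2) * β ^ (12 * θ)))) ^ 2 by ring,
    Real.sqrt_mul' _ (sq_nonneg _), Real.sqrt_sq (by positivity)]
  ring

/-- **The Gaussian chart bound**: with `R' ≤ cR·β^{3θ+θ/5}` (`β ≥ 1`),
`mE = √D(12H²+2H+1)((R+R') + 4√β·r)/√β ≤ (12H²+2H+1)·(β^{6θ−1/2}/4 + √D(cR + 4Ca)·β^{3θ+θ/5−1/2})`. [folklore] -/
theorem mED_le (D : ℕ) {β θ Ca cR R' : ℝ} (hβ : 1 ≤ β) (hθ : 0 ≤ θ) (hCa : 0 ≤ Ca) (hR' : R' ≤ cR * β ^ (3 * θ + θ / 5)) :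
    Real.sqrt D * ((12 * (⌈β ^ θ⌉₊ : ℝ) ^ 2 + 2 * ⌈β ^ θ⌉₊ + 1) *
        ((β ^ (6 * θ) / (4 * (Real.sqrt D + 1)) + R') + 4 * (Real.sqrt β * (Ca * β ^ (3 * θ + θ / 5 - 1 / 2))))) / Real.sqrt β ≤
      (12 * (⌈β ^ θ⌉₊ : ℝ) ^ 2 + 2 * ⌈β ^ θ⌉₊ + 1) *
        (β ^ (6 * θ - 1 / 2) / 4 + Real.sqrt D * (cR + 4 * Ca) * β ^ (3 * θ + θ / 5 - 1 / 2)) := by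
  have hβ0 : 0 < β := by linarith
  have hsβ : 0 < Real.sqrt β := Real.sqrt_pos.2 hβ0
  obtain ⟨hsr, -⟩ := datumRadius_facts hβ hθ hCa
  set PH : ℝ := 12 * (⌈β ^ θ⌉₊ : ℝ) ^ 2 + 2 * ⌈β ^ θ⌉₊ + 1 with hPH
  have hPH0 : 0 ≤ PH := by positivity
  have hD0 : 0 ≤ Real.sqrt (D : ℝ) := Real.sqrt_nonneg _
  -- split the three pieces
  have hR := sqrtD_mul_gaussRadiusD_div_le D (θ := θ) hβ0
  have hdiv : β ^ (3 * θ + θ / 5) / Real.sqrt β = β ^ (3 * θ + θ / 5 - 1 / 2) := by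
    rw [Real.sqrt_eq_rpow, ← Real.rpow_sub hβ0]
  have hR'' : Real.sqrt D * R' / Real.sqrt β ≤ Real.sqrt D * cR * β ^ (3 * θ + θ / 5 - 1 / 2) := by
    rw [← hdiv, div_eq_mul_one_div, div_eq_mul_one_div (β ^ (3 * θ + θ / 5))]
    have : Real.sqrt D * R' ≤ Real.sqrt D * (cR * β ^ (3 * θ + θ / 5)) := mul_le_mul_of_nonneg_left hR' hD0
    have h1 : 0 ≤ 1 / Real.sqrt β := by positivity
    nlinarith
  have hr'' : Real.sqrt D * (4 * (Real.sqrt β * (Ca * β ^ (3 * θ + θ / 5 - 1 / 2)))) / Real.sqrt β =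
      Real.sqrt D * (4 * Ca) * β ^ (3 * θ + θ / 5 - 1 / 2) := by
    field_simp
  have hsplit : Real.sqrt D * (PH * ((β ^ (6 * θ) / (4 * (Real.sqrt D + 1)) + R') +
      4 * (Real.sqrt β * (Ca * β ^ (3 * θ + θ / 5 - 1 / 2))))) / Real.sqrt β =
      PH * (Real.sqrt D * (β ^ (6 * θ) / (4 * (Real.sqrt D + 1))) / Real.sqrt β + Real.sqrt D * R' / Real.sqrt β +
        Real.sqrt D * (4 * (Real.sqrt β * (Ca * β ^ (3 * θ + θ / 5 - 1 / 2)))) / Real.sqrt β) := by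
    field_simp
  rw [hsplit, hr'']
  refine mul_le_mul_of_nonneg_left ?_ hPH0
  calc Real.sqrt D * (β ^ (6 * θ) / (4 * (Real.sqrt D + 1))) / Real.sqrt β + Real.sqrt D * R' / Real.sqrt β +
        Real.sqrt D * (4 * Ca) * β ^ (3 * θ + θ / 5 - 1 / 2)
      ≤ β ^ (6 * θ - 1 / 2) / 4 + Real.sqrt D * cR * β ^ (3 * θ + θ / 5 - 1 / 2) + Real.sqrt D * (4 * Ca) * β ^ (3 * θ + θ / 5 - 1 / 2) := by
        linarith
    _ = β ^ (6 * θ - 1 / 2) / 4 + Real.sqrt D * (cR + 4 * Ca) * β ^ (3 * θ + θ / 5 - 1 / 2) := by ring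

end Summit.QuantumFields.YangMills.Theorems.ColdBoxAllGroups

end
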